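import Summits.QuantumFields.YangMills.Theorems.UnitScaleTiltHalvingDbarStraightMean
import Summits.QuantumFields.YangMills.Theorems.UnitScaleTiltHalvingDbavgOneStepLocal
import Summits.QuantumFields.YangMills.Theorems.UnitScaleTiltHalvingCombTubeDictionary
import HarnessLib

/-!
# Line H (`BirthV10.stub_halvingStep`, stmt-QuantumFields-19200) — LEMMA B-al, (B-al-1) in a FIXED COMMON SMALL GAUGE: ★★★ ONE STEP OF THE `ℤᵈ` FLAT DOUBLE BAR
# ([Balaban1985Averaging] (89)∕(121)) AND ONE STEP OF THE TORUS DOUBLE BAR ([Balaban1987RG1] (0.4) with frames) AGREE TO SECOND ORDER at every level `j`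

Cell `ym3-torus` (HUMAN RULING D-0037: YM₃ on T³ is ladder rung R3 — NOT d = 4, NOT infinite volume, NOT a mass gap, NOT the Clay problem), width seat `ym-ust-19200-w3` gen 10
(LEAD-H ★w5-19200 g7 WORD 10 (2): LEMMA B-al ≡ (N1); SIGNATURE memo 67606d20 §2 (B-al-1)).  `--supports stmt-QuantumFields-19200 --as helper`; THEOREMS ONLY (0 `def`,
0 `sorry`); count-neutral; nothing here claims B-al-2∕3, `H42topCrossT`, (M2′), the stub, the crux or the gap.

WHAT.  The triangle over the three bricks: ℤᵈ ✓`HalvingDbavgOneStepLocal.norm_mlog_dbavg_sub_linQ_le_local` (`‖log dbavg(e^B)(c) − linQ B c‖ ≤ C₂(d)(Lb)²`, local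
hypothesis), dictionary ✓`HalvingCombTubeDictionary.linQ_eq_smul_bondAvg_coverAt` (`linQ B (L•z) κ = L·bondAvg X ⟨π_{j+1}z, κ⟩` for `B = X ∘ π_j`), torus
✓`HalvingDbarStraightMean.norm_mlog_dbarAvgU_sub_smul_bondAvg_le` (`‖log dbarAvgU S ĉ − L·bondAvg X ĉ‖ ≤ 40000((d+2)L)²r²`, `S = e^X`):
★★★ `norm_mlog_dbavg_sub_mlog_dbarAvgU_le` — for a level-`j` torus field `S = exp X` with `‖X‖ ≤ r` on the bonds of the block pair of `ĉ = ⟨π_{j+1} z, κ⟩`, and the `ℤᵈ`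
pulled logarithm `B = X ∘ π_j` with `‖B‖ ≤ r` on the bonds of the corner box `[L·z, L·z + (L−1)𝟙 + L e_κ]`, under `L·r ≤ c₄(d)`, `200(d+2)L·r ≤ 1`:
`‖mlog (dbavg L (expCfg B) (L•z) κ) − mlog (dbarAvgU S ĉ)‖ ≤ (C₂(d) + 40000·(d+2)²)·(L·r)²` — the two one-step double bars of the SAME field differ at SECOND order in the
local field size, with NO first-order (gauge) term (memo (F1): both first orders are the plain tube mean; px3 g4 (V4)).  This is the fixed-gauge form; B-al-2 applies it in a LOCAL
axial gauge at every block pair and level (memo (F3)), where `r = O(L²·q_j)`.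
HONEST SCOPE.  A triangle inequality over three landed∕filed bricks; the two second-order estimates are lit ✓`prop4_flat`'s and ✓`norm_mlog_dbar_sub_segMean_le`'s; B-al-2 (the
induction with exact covariance and one-step Lipschitz) and B-al-3 (open path) are NOT here.

References: T. Bałaban, CMP **98** (1985) 17–51 [Balaban1985Averaging] ((89) p.31, (121)–(125) p.36, Prop. 4 (134)–(135) pp.38–39); CMP **116** (1988) [Balaban1987RG1]
((0.1)–(0.4) pp.251–253); CMP **95** (1984) 17–40 [Balaban1984PropagatorsI] ((1.11) p.19).
-/

set_option autoImplicit false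

noncomputable section

open scoped BigOperators Matrix.Norms.L2Operator
open NormedSpace

namespace Summit.QuantumFields.YangMills.Theorems.HalvingCombTorusOneStep

open Literature.MathematicalPhysics.QuantumFieldTheory.Balaban1983to89
open T4Continuum LatticeFieldCalculus
open B14DomainGeom (Pt)
open Node00 (coverAt)
open B7Prop1Explicit (e)
open B7Prop1Local (InBox bondHi)
open B7Prop3Flat (dbavg linQ expCfg)
open B7Prop4Flat (C2 c4)
open MatrixLog (mlog)
open Summit.QuantumFields.YangMills.Theorems.Prop8ChartDoubleBar (dbarAvgU)
open HalvingDbarStraightMean (norm_mlog_dbarAvgU_sub_smul_bondAvg_le)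
open HalvingDbavgOneStepLocal (norm_mlog_dbavg_sub_linQ_le_local)
open HalvingCombTubeDictionary (linQ_eq_smul_bondAvg_coverAt)

variable {P : Params} {j : ℕ} {n : Type*} [Fintype n] [DecidableEq n] [Nonempty n]

/-- ★★★ **(B-al-1), FIXED COMMON SMALL GAUGE: the `ℤᵈ` flat double bar and the torus double bar of the same level-`j` field agree to second order in the local field size.**
[cite: Balaban1985Averaging, (89) p.31, (121)-(125) p.36, Prop. 4 (134)-(135) pp.38-39; Balaban1987RG1, (0.4) p.253; Balaban1984PropagatorsI, (1.11) p.19] -/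
theorem norm_mlog_dbavg_sub_mlog_dbarAvgU_le (hj : j + 1 ≤ P.m + P.K) (hL : 2 ≤ P.L)
    {S : GaugeField P j (Matrix n n ℂ)ˣ} {X : PBond P j → Matrix n n ℂ} (B : Pt P.d → Fin P.d → Matrix n n ℂ)
    (hBA : ∀ w μ, B w μ = X ⟨coverAt P j w, μ⟩) (z : Pt P.d) (κ : Fin P.d) {r : ℝ} (hr0 : 0 ≤ r)
    (hLr : (P.L : ℝ) * r ≤ c4 P.d) (hℓr : 200 * (((P.d + 2) * P.L : ℕ) : ℝ) * r ≤ 1)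
    -- torus: `S = exp X`, `‖X‖ ≤ r` on the bonds of the block pair of `ĉ`
    (hSX : ∀ b : PBond P j, (blockOf b.src = coverAt P (j + 1) z ∨ blockOf b.src = (⟨coverAt P (j + 1) z, κ⟩ : PBond P (j + 1)).tgt) →
      (blockOf b.tgt = coverAt P (j + 1) z ∨ blockOf b.tgt = (⟨coverAt P (j + 1) z, κ⟩ : PBond P (j + 1)).tgt) → ((S b : (Matrix n n ℂ)ˣ) : Matrix n n ℂ) = exp (X b))
    (hX : ∀ b : PBond P j, (blockOf b.src = coverAt P (j + 1) z ∨ blockOf b.src = (⟨coverAt P (j + 1) z, κ⟩ : PBond P (j + 1)).tgt) →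
      (blockOf b.tgt = coverAt P (j + 1) z ∨ blockOf b.tgt = (⟨coverAt P (j + 1) z, κ⟩ : PBond P (j + 1)).tgt) → ‖X b‖ ≤ r)
    -- ℤᵈ: `‖B‖ ≤ r` on the bonds of the corner box of the `L`-bond `⟨L·z, L·z + L e_κ⟩`
    (hB : ∀ x μ, InBox ((P.L : ℤ) • z) (bondHi P.L ((P.L : ℤ) • z) κ) x → InBox ((P.L : ℤ) • z) (bondHi P.L ((P.L : ℤ) • z) κ) (x + e μ) → ‖B x μ‖ ≤ r) :
    ‖mlog ((dbavg P.L (expCfg B) ((P.L : ℤ) • z) κ : (Matrix n n ℂ)ˣ) : Matrix n n ℂ) -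
        mlog ((dbarAvgU S ⟨coverAt P (j + 1) z, κ⟩ : (Matrix n n ℂ)ˣ) : Matrix n n ℂ)‖ ≤
      (C2 P.d + 40000 * ((P.d : ℝ) + 2) ^ 2) * ((P.L : ℝ) * r) ^ 2 := by
  have hZ := (norm_mlog_dbavg_sub_linQ_le_local P.L hL B z κ hr0 hLr hB).1
  have hT := norm_mlog_dbarAvgU_sub_smul_bondAvg_le hj ⟨coverAt P (j + 1) z, κ⟩ hr0 hℓr hSX hX
  rw [linQ_eq_smul_bondAvg_coverAt hj X B hBA z κ] at hZ
  have hcast : 40000 * (((P.d + 2) * P.L : ℕ) : ℝ) ^ 2 * r ^ 2 = 40000 * ((P.d : ℝ) + 2) ^ 2 * ((P.L : ℝ) * r) ^ 2 := by push_cast; ring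
  calc _ ≤ ‖mlog ((dbavg P.L (expCfg B) ((P.L : ℤ) • z) κ : (Matrix n n ℂ)ˣ) : Matrix n n ℂ) - ((P.L : ℕ) : ℂ) • bondAvg X ⟨coverAt P (j + 1) z, κ⟩‖ +
        ‖((P.L : ℕ) : ℂ) • bondAvg X ⟨coverAt P (j + 1) z, κ⟩ - mlog ((dbarAvgU S ⟨coverAt P (j + 1) z, κ⟩ : (Matrix n n ℂ)ˣ) : Matrix n n ℂ)‖ :=
          norm_sub_le_norm_sub_add_norm_sub _ _ _
    _ ≤ C2 P.d * ((P.L : ℝ) * r) ^ 2 + 40000 * (((P.d + 2) * P.L : ℕ) : ℝ) ^ 2 * r ^ 2 :=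
          add_le_add hZ (by rw [norm_sub_rev]; exact hT)
    _ = (C2 P.d + 40000 * ((P.d : ℝ) + 2) ^ 2) * ((P.L : ℝ) * r) ^ 2 := by rw [hcast]; ring

end Summit.QuantumFields.YangMills.Theorems.HalvingCombTorusOneStep

end
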